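import Literature.AlgebraicGeometry.Deformation.SmoothSchemeLiftObstructionCriterionGlueTrivial
import HarnessLib

/-!
# Gluing the lifted charts, X: the CLOSED FIBRE of the glued deformation is `X`
# (Hartshorne, *Deformation Theory*, proof of Thm. 10.2 (a): «… a flat scheme `X'` over `Spec A'` with `X' ×_{A'} k = X`»)

HOME SEED (cell `hodgecm-mathlib`, F-11 (A3) F3b FILE 6b; provisional path
`Deformation/SmoothSchemeLiftObstructionCriterionGlueClosedFibre.lean`).  Theorems only; imports FILE 6a.

Over the coefficient field `k` itself, trivial gluing data re-glue the charts `Spec (k ⊗_k Γ(U j)) ≅ U j` along the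
identity: the projection `π : X'_k(1) ⟶ X` of FILE 6a is an ISOMORPHISM once the `U j` cover `X` (isomorphisms are
Zariski-local at the target; over `U j` the map is the chart `Spec (k ⊗_k Γ(U j)) ≅ Spec Γ(U j) ≅ U j`, FILE 6a
`preimage_proj_eq_opensRange`), and it lies over `Spec k`.  Combined with the cartesian square of FILE 5 along an
AUGMENTATION `ε : R → k` killing `𝔫` (compatibility: FILE 6a), the glued deformation `q : X'_R → Spec R` of admissible
cocycle-exact lifted gluing data `ψ` has CLOSED FIBRE `X`:

* §1 `isIso_SpecMap_includeRight` (`Spec (k ⊗_k B) ≅ Spec B`), `fromSpec_comp_hom` (`Spec Γ(U) → U ↪ X → Spec k` is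
  `Spec` of the scalars);
* §2 `isPullback_ι_proj`, **`isIso_proj`**, `proj_comp_structureMap` — `π : X'_k(1) ≅ X` over `Spec k`;
* §3 **`exists_closedFibre_isPullback`** — a morphism `Φ₀ : X ⟶ X'_R`, on `U j` equal to
  `Spec (a ⊗ c ↦ ε(a) c) ≫ ι j`, with `X = X'_R ×_{Spec R} Spec k` (cartesian over `Spec ε`).

HC_CM is proved only modulo the 7 printed citations until rung 0 closes — nothing here bears on a summit statement.

## References
* [Hartshorne2010] R. Hartshorne, *Deformation Theory*, GTM 257, Springer (2010): Thm. 10.2 (a) and its proof (p. 81);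
  §5 p. 38.
* [StacksProject] The Stacks Project, Tag 01JA (glueing schemes), Tag 01LH (relative glueing), Tag 02XE.
* [Hartshorne1977] R. Hartshorne, *Algebraic Geometry*, GTM 52 (1977): II Prop. 2.2, II Ex. 2.16 (a), II.8 p. 172.
* [AtiyahMacdonald1969] M. F. Atiyah, I. G. Macdonald, *Introduction to Commutative Algebra* (1969): Ch. 2 (pp. 30–31).
-/

noncomputable section

-- `TopCat.Presheaf`/`TopCat.Sheaf` are not reducible (as in Mathlib's `AlgebraicGeometry/Modules`).
set_option backward.isDefEq.respectTransparency false

open CategoryTheory AlgebraicGeometry Opposite TopologicalSpace Limits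
open scoped TensorProduct

universe u

namespace Literature.AlgebraicGeometry.Deformation

open Literature.AlgebraicGeometry.Motives Literature.AlgebraicGeometry.Morphisms

variable {k : Type u} [Field k] {X : Over (Spec (CommRingCat.of k))}
  [instΓ : ∀ W : X.left.Opens, Algebra k Γ(X.left, W)]
  (halg : ∀ (W : X.left.Opens) (s : k), algebraMap k Γ(X.left, W) s = (constToPresheaf X).app (op W) s)
  {ι : Type u} (U : ι → X.left.affineOpens) (b : (j l : ι) → Γ(X.left, (U j).1))
  (hb : ∀ j l, (U j).1 ⊓ (U l).1 = X.left.basicOpen (b j l))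
  (ψ₀ : (j l : ι) → k ⊗[k] Γ(X.left, (U j).1 ⊓ (U l).1) ≃ₐ[k] k ⊗[k] Γ(X.left, (U j).1 ⊓ (U l).1))
  (𝔫₀ : Ideal k) (h𝔫₀ : IsNilpotent 𝔫₀)
  (hψ₀ : ∀ j l x, ψ₀ j l x - x ∈ 𝔫₀ • (⊤ : Submodule k (k ⊗[k] Γ(X.left, (U j).1 ⊓ (U l).1))))
  (hcoc₀ : ∀ (j l m : ι)
    (Φjl : k ⊗[k] Γ(X.left, (U j).1 ⊓ (U l).1) →ₐ[k] k ⊗[k] Γ(X.left, (U j).1 ⊓ (U l).1 ⊓ (U m).1))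
    (_ : ∀ a s, Φjl (a ⊗ₜ s) = a ⊗ₜ X.left.presheaf.map (homOfLE inf_le_left).op s)
    (Φlm : k ⊗[k] Γ(X.left, (U l).1 ⊓ (U m).1) →ₐ[k] k ⊗[k] Γ(X.left, (U j).1 ⊓ (U l).1 ⊓ (U m).1))
    (_ : ∀ a s, Φlm (a ⊗ₜ s) = a ⊗ₜ X.left.presheaf.map
      (homOfLE (le_inf (inf_le_left.trans inf_le_right) inf_le_right)).op s)
    (Φjm : k ⊗[k] Γ(X.left, (U j).1 ⊓ (U m).1) →ₐ[k] k ⊗[k] Γ(X.left, (U j).1 ⊓ (U l).1 ⊓ (U m).1))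
    (_ : ∀ a s, Φjm (a ⊗ₜ s) = a ⊗ₜ X.left.presheaf.map
      (homOfLE (le_inf (inf_le_left.trans inf_le_left) inf_le_right)).op s)
    (ρjl ρlm ρjm : k ⊗[k] Γ(X.left, (U j).1 ⊓ (U l).1 ⊓ (U m).1) ≃ₐ[k]
      k ⊗[k] Γ(X.left, (U j).1 ⊓ (U l).1 ⊓ (U m).1)),
    (∀ x, ρjl (Φjl x) = Φjl (ψ₀ j l x)) → (∀ x, ρlm (Φlm x) = Φlm (ψ₀ l m x)) →
    (∀ x, ρjm (Φjm x) = Φjm (ψ₀ j m x)) → ρlm * ρjl = ρjm)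
  (hψ₀1 : ∀ j l x, ψ₀ j l x = x)

/-! ## §1 Affine preliminaries over the coefficient field -/

omit instΓ in
/-- `Spec (k ⊗_k B) → Spec B` (`Spec` of `c ↦ 1 ⊗ c`) is an isomorphism (`k ⊗_k B ≅ B`, Mathlib `TensorProduct.lid`).
[cite: AtiyahMacdonald1969, Ch. 2 (tensor product of algebras, pp. 30–31)] -/
theorem isIso_SpecMap_includeRight (B : Type u) [CommRing B] [Algebra k B] :
    IsIso (Spec.map (CommRingCat.ofHom (Algebra.TensorProduct.includeRight (R := k) (A := k) (B := B)).toRingHom)) := by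
  have e : CommRingCat.ofHom (Algebra.TensorProduct.includeRight (R := k) (A := k) (B := B)).toRingHom =
      (Algebra.TensorProduct.lid k B).symm.toRingEquiv.toCommRingCatIso.hom :=
    CommRingCat.hom_ext (RingHom.ext fun c => rfl)
  rw [e]
  infer_instance

include halg in
/-- **`Spec Γ(U) → U ↪ X → Spec k` is `Spec` of the scalars `k → Γ(U)`** for an affine open `U` of the `k`-scheme `X`
(Mathlib `IsAffineOpen.SpecMap_appLE_fromSpec` for `X → Spec k`, and FILE 3 `ofHom_algebraMap_eq`).
[cite: Hartshorne1977, II.8 p. 172 (the `k`-structure of `𝒪_X`); II Prop. 2.3] -/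
theorem fromSpec_comp_hom {V : X.left.Opens} (hV : IsAffineOpen V) :
    hV.fromSpec ≫ X.hom = Spec.map (CommRingCat.ofHom (algebraMap k Γ(X.left, V))) := by
  have h1 := IsAffineOpen.SpecMap_appLE_fromSpec X.hom (isAffineOpen_top _) hV (V := V) (U := ⊤) le_top
  rw [IsAffineOpen.fromSpec_top, Scheme.isoSpec_Spec_inv, ← Spec.map_comp] at h1
  rw [← h1, ofHom_algebraMap_eq halg V]

omit instΓ in
/-- `(c ↦ 1 ⊗ c) ∘ (k → Γ(U)) = (a ↦ a ⊗ 1) : k → k ⊗_k Γ(U)`. [cite: AtiyahMacdonald1969, Ch. 2 (pp. 30–31)] -/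
theorem includeRight_comp_algebraMap (B : Type u) [CommRing B] [Algebra k B] :
    (Algebra.TensorProduct.includeRight (R := k) (A := k) (B := B)).toRingHom.comp (algebraMap k B) =
      Algebra.TensorProduct.includeLeftRingHom := by
  refine RingHom.ext fun s => ?_
  change (1 : k) ⊗ₜ[k] algebraMap k B s = s ⊗ₜ[k] (1 : B)
  rw [Algebra.algebraMap_eq_smul_one, TensorProduct.tmul_smul, TensorProduct.smul_tmul', smul_eq_mul, mul_one]

/-! ## §2 The re-glued closed fibre is `X` -/

/-- The chart isomorphism `Spec (k ⊗_k Γ(U j)) ≅ U j` followed by `U j ↪ X` is the chart projection.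
[cite: Hartshorne2010, Thm. 10.2 (proof), p. 81] -/
theorem chartIso_comp_ι (j : ι) :
    (Spec.map (CommRingCat.ofHom (Algebra.TensorProduct.includeRight (R := k) (A := k) (B := Γ(X.left, (U j).1))).toRingHom) ≫
      (U j).2.isoSpec.inv) ≫ (U j).1.ι = chartProj k U j := by
  rw [Category.assoc, IsAffineOpen.isoSpec_inv_ι, chartProj_eq]

/-- **The chart squares of `π` are CARTESIAN**: `Spec (k ⊗_k Γ(U j)) = π⁻¹(U j)` (FILE 6a `preimage_proj_eq_opensRange` +
Mathlib `IsOpenImmersion.isPullback`). [cite: StacksProject, Tag 01LH] [cite: Hartshorne2010, Thm. 10.2 (proof), p. 81] -/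
theorem isPullback_ι_proj
    (π : (deformationGlueDatum halg k U b hb ψ₀ 𝔫₀ h𝔫₀ hψ₀ hcoc₀).glueData.glued ⟶ X.left)
    (hπ : ∀ j, (deformationGlueDatum halg k U b hb ψ₀ 𝔫₀ h𝔫₀ hψ₀ hcoc₀).glueData.ι j ≫ π = chartProj k U j) (j : ι) :
    IsPullback ((deformationGlueDatum halg k U b hb ψ₀ 𝔫₀ h𝔫₀ hψ₀ hcoc₀).glueData.ι j)
      (Spec.map (CommRingCat.ofHom
        (Algebra.TensorProduct.includeRight (R := k) (A := k) (B := Γ(X.left, (U j).1))).toRingHom) ≫ (U j).2.isoSpec.inv)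
      π (U j).1.ι :=
  (IsOpenImmersion.isPullback _ _ _ π (by rw [hπ j, chartIso_comp_ι])
    (by rw [Scheme.Opens.opensRange_ι]; exact preimage_proj_eq_opensRange halg k U b hb ψ₀ 𝔫₀ h𝔫₀ hψ₀ hcoc₀ π hπ j)).flip

/-- **THE RE-GLUED CLOSED FIBRE IS `X`**: when the `U j` cover `X`, the projection `π : X'_k(1) ⟶ X` is an ISOMORPHISM
(isomorphisms are Zariski-local at the target; over `U j` it is the chart isomorphism `Spec (k ⊗_k Γ(U j)) ≅ U j` by the
cartesian chart square). [cite: Hartshorne2010, Thm. 10.2 (proof), p. 81] [cite: StacksProject, Tag 01JA; Tag 01LH] -/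
theorem isIso_proj (hU : IsOpenCover fun j => (U j).1)
    (π : (deformationGlueDatum halg k U b hb ψ₀ 𝔫₀ h𝔫₀ hψ₀ hcoc₀).glueData.glued ⟶ X.left)
    (hπ : ∀ j, (deformationGlueDatum halg k U b hb ψ₀ 𝔫₀ h𝔫₀ hψ₀ hcoc₀).glueData.ι j ≫ π = chartProj k U j) : IsIso π := by
  have h : (MorphismProperty.isomorphisms Scheme.{u}) π := by
    refine IsZariskiLocalAtTarget.of_openCover (P := MorphismProperty.isomorphisms Scheme.{u})
      (X.left.openCoverOfIsOpenCover (fun j => (U j).1) hU) fun j => ?_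
    have hc := isPullback_ι_proj halg U b hb ψ₀ 𝔫₀ h𝔫₀ hψ₀ hcoc₀ π hπ j
    haveI := isIso_SpecMap_includeRight (k := k) Γ(X.left, (U j).1)
    change IsIso (pullback.snd π (U j).1.ι)
    rw [← hc.isoPullback_inv_snd]
    infer_instance
  exact h

include halg in
/-- **`π` lies over `Spec k`**: `π ≫ (X → Spec k) = q₀`, the structure map of the re-glued scheme (FILE 3) — on the chart
`j` both are `Spec (k → k ⊗_k Γ(U j))` (§1). [cite: Hartshorne2010, Thm. 10.2 (proof), p. 81] [cite: StacksProject, Tag 01LH] -/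
theorem proj_comp_hom
    (π : (deformationGlueDatum halg k U b hb ψ₀ 𝔫₀ h𝔫₀ hψ₀ hcoc₀).glueData.glued ⟶ X.left)
    (hπ : ∀ j, (deformationGlueDatum halg k U b hb ψ₀ 𝔫₀ h𝔫₀ hψ₀ hcoc₀).glueData.ι j ≫ π = chartProj k U j)
    (q₀ : (deformationGlueDatum halg k U b hb ψ₀ 𝔫₀ h𝔫₀ hψ₀ hcoc₀).glueData.glued ⟶ Spec (CommRingCat.of k))
    (hq₀ : ∀ j, (deformationGlueDatum halg k U b hb ψ₀ 𝔫₀ h𝔫₀ hψ₀ hcoc₀).glueData.ι j ≫ q₀ =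
      Spec.map (CommRingCat.ofHom (Algebra.TensorProduct.includeLeftRingHom
        (R := k) (A := k) (B := Γ(X.left, (U j).1))))) :
    π ≫ X.hom = q₀ := by
  refine glueData_hom_ext _ _ _ fun j => ?_
  rw [← Category.assoc, hπ j, hq₀ j, chartProj_eq, Category.assoc, fromSpec_comp_hom halg (U j).2, ← Spec.map_comp,
    ← CommRingCat.ofHom_comp, includeRight_comp_algebraMap]

/-! ## §3 The closed fibre of the glued deformation along an augmentation -/

variable (R : Type u) [CommRing R] [Algebra k R]
  (ψ : (j l : ι) → R ⊗[k] Γ(X.left, (U j).1 ⊓ (U l).1) ≃ₐ[R] R ⊗[k] Γ(X.left, (U j).1 ⊓ (U l).1))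
  (𝔫 : Ideal R) (h𝔫 : IsNilpotent 𝔫)
  (hψ : ∀ j l x, ψ j l x - x ∈ 𝔫 • (⊤ : Submodule R (R ⊗[k] Γ(X.left, (U j).1 ⊓ (U l).1))))
  (hcoc : ∀ (j l m : ι)
    (Φjl : R ⊗[k] Γ(X.left, (U j).1 ⊓ (U l).1) →ₐ[R] R ⊗[k] Γ(X.left, (U j).1 ⊓ (U l).1 ⊓ (U m).1))
    (_ : ∀ a s, Φjl (a ⊗ₜ s) = a ⊗ₜ X.left.presheaf.map (homOfLE inf_le_left).op s)
    (Φlm : R ⊗[k] Γ(X.left, (U l).1 ⊓ (U m).1) →ₐ[R] R ⊗[k] Γ(X.left, (U j).1 ⊓ (U l).1 ⊓ (U m).1))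
    (_ : ∀ a s, Φlm (a ⊗ₜ s) = a ⊗ₜ X.left.presheaf.map
      (homOfLE (le_inf (inf_le_left.trans inf_le_right) inf_le_right)).op s)
    (Φjm : R ⊗[k] Γ(X.left, (U j).1 ⊓ (U m).1) →ₐ[R] R ⊗[k] Γ(X.left, (U j).1 ⊓ (U l).1 ⊓ (U m).1))
    (_ : ∀ a s, Φjm (a ⊗ₜ s) = a ⊗ₜ X.left.presheaf.map
      (homOfLE (le_inf (inf_le_left.trans inf_le_left) inf_le_right)).op s)
    (ρjl ρlm ρjm : R ⊗[k] Γ(X.left, (U j).1 ⊓ (U l).1 ⊓ (U m).1) ≃ₐ[R]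
      R ⊗[k] Γ(X.left, (U j).1 ⊓ (U l).1 ⊓ (U m).1)),
    (∀ x, ρjl (Φjl x) = Φjl (ψ j l x)) → (∀ x, ρlm (Φlm x) = Φlm (ψ l m x)) →
    (∀ x, ρjm (Φjm x) = Φjm (ψ j m x)) → ρlm * ρjl = ρjm)

omit instΓ in
/-- `(c ↦ 1 ⊗ c) ∘ (a ⊗ c ↦ ε(a) c) = ε ⊗ 1 : R ⊗_k B → k ⊗_k B`. [cite: AtiyahMacdonald1969, Ch. 2 (pp. 30–31)] -/
theorem includeRight_comp_lid_comp_map (B : Type u) [CommRing B] [Algebra k B] (ε : R →ₐ[k] k) :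
    (Algebra.TensorProduct.includeRight (R := k) (A := k) (B := B)).toRingHom.comp
      ((Algebra.TensorProduct.lid k B).toAlgHom.comp (Algebra.TensorProduct.map ε (AlgHom.id k B))).toRingHom =
      (Algebra.TensorProduct.map ε (AlgHom.id k B)).toRingHom := by
  refine ringHom_ext_tmul (fun r => ?_) (fun c => ?_)
  · change (1 : k) ⊗ₜ[k] (Algebra.TensorProduct.lid k B) (Algebra.TensorProduct.map ε (AlgHom.id k B) (r ⊗ₜ 1)) =
      Algebra.TensorProduct.map ε (AlgHom.id k B) (r ⊗ₜ 1)
    rw [Algebra.TensorProduct.map_tmul, Algebra.TensorProduct.lid_tmul, TensorProduct.tmul_smul, TensorProduct.smul_tmul',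
      smul_eq_mul, mul_one]
  · change (1 : k) ⊗ₜ[k] (Algebra.TensorProduct.lid k B) (Algebra.TensorProduct.map ε (AlgHom.id k B) (1 ⊗ₜ c)) =
      Algebra.TensorProduct.map ε (AlgHom.id k B) (1 ⊗ₜ c)
    rw [Algebra.TensorProduct.map_tmul, map_one, Algebra.TensorProduct.lid_tmul, one_smul]

include 𝔫₀ h𝔫₀ hψ₀ hcoc₀ hψ₀1 halg in
/-- **THE CLOSED FIBRE OF THE GLUED DEFORMATION IS `X`** («a flat `X'` over `Spec A'` with `X' ×_{A'} k = X»): for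
admissible cocycle-exact lifted gluing data `ψ ≡ 1 (mod 𝔫)` over `R`, an AUGMENTATION `ε : R → k` killing `𝔫`, a
covering principal affine cover `U`, and the structure map `q : X'_R → Spec R` (FILE 3), there is `Φ₀ : X ⟶ X'_R` — on
`U j` it is `Spec (a ⊗ c ↦ ε(a) c) ≫ ι j` — making `X ─Φ₀→ X'_R`, `X → Spec k ─Spec ε→ Spec R` (`q`) CARTESIAN.
(The closed-fibre datum over `k` is any trivial `ψ₀`; FILE 6a supplies `ψ₀ ≡ 1`-admissibility and cocycle-exactness.)
[cite: Hartshorne2010, Thm. 10.2 (a) and its proof, p. 81] [cite: StacksProject, Tag 01LH; Tag 02XE] -/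
theorem exists_closedFibre_isPullback (ε : R →ₐ[k] k) (hε : ∀ n ∈ 𝔫, ε n = 0) (hU : IsOpenCover fun j => (U j).1)
    (q : (deformationGlueDatum halg R U b hb ψ 𝔫 h𝔫 hψ hcoc).glueData.glued ⟶ Spec (CommRingCat.of R))
    (hq : ∀ j, (deformationGlueDatum halg R U b hb ψ 𝔫 h𝔫 hψ hcoc).glueData.ι j ≫ q =
      Spec.map (CommRingCat.ofHom (Algebra.TensorProduct.includeLeftRingHom
        (R := k) (A := R) (B := Γ(X.left, (U j).1))))) :
    ∃ Φ₀ : X.left ⟶ (deformationGlueDatum halg R U b hb ψ 𝔫 h𝔫 hψ hcoc).glueData.glued,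
      (∀ j, (U j).2.fromSpec ≫ Φ₀ = Spec.map (CommRingCat.ofHom
        ((Algebra.TensorProduct.lid k Γ(X.left, (U j).1)).toAlgHom.comp
          (Algebra.TensorProduct.map ε (AlgHom.id k Γ(X.left, (U j).1)))).toRingHom) ≫
          (deformationGlueDatum halg R U b hb ψ 𝔫 h𝔫 hψ hcoc).glueData.ι j) ∧
      IsPullback Φ₀ X.hom q (Spec.map (CommRingCat.ofHom ε.toRingHom)) := by
  obtain ⟨π, hπ, -⟩ := existsUnique_proj halg k U b hb ψ₀ 𝔫₀ h𝔫₀ hψ₀ hcoc₀ hψ₀1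
  obtain ⟨q₀, hq₀, -⟩ := existsUnique_structureMap halg k U b hb ψ₀ 𝔫₀ h𝔫₀ hψ₀ hcoc₀
  haveI := isIso_proj halg U b hb ψ₀ 𝔫₀ h𝔫₀ hψ₀ hcoc₀ hU π hπ
  obtain ⟨Φ, hΦ, -, hpb⟩ := exists_baseChangeMap_isPullback halg ε U b hb ψ ψ₀ 𝔫 h𝔫 𝔫₀ h𝔫₀ hψ hψ₀ hcoc hcoc₀
    (compatible_of_trivial R U ψ 𝔫 hψ ε hε ψ₀ hψ₀1) q hq q₀ hq₀
  refine ⟨inv π ≫ Φ, fun j => ?_, ?_⟩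
  · haveI := isIso_SpecMap_includeRight (k := k) Γ(X.left, (U j).1)
    have e1 : (U j).2.fromSpec = inv (Spec.map (CommRingCat.ofHom
        (Algebra.TensorProduct.includeRight (R := k) (A := k) (B := Γ(X.left, (U j).1))).toRingHom)) ≫
        (deformationGlueDatum halg k U b hb ψ₀ 𝔫₀ h𝔫₀ hψ₀ hcoc₀).glueData.ι j ≫ π := by
      rw [hπ j, chartProj_eq, IsIso.inv_hom_id_assoc]
    rw [e1, Category.assoc, Category.assoc, IsIso.hom_inv_id_assoc, hΦ j, ← Category.assoc]
    congr 1
    rw [IsIso.inv_comp_eq, ← Spec.map_comp, ← CommRingCat.ofHom_comp, includeRight_comp_lid_comp_map]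
  · refine hpb.of_iso (asIso π) (Iso.refl _) (Iso.refl _) (Iso.refl _) ?_ ?_ ?_ ?_
    · rw [Iso.refl_hom, Category.comp_id, asIso_hom, IsIso.hom_inv_id_assoc]
    · rw [Iso.refl_hom, Category.comp_id, asIso_hom, proj_comp_hom halg U b hb ψ₀ 𝔫₀ h𝔫₀ hψ₀ hcoc₀ π hπ q₀ hq₀]
    · rw [Iso.refl_hom, Iso.refl_hom, Category.comp_id, Category.id_comp]
    · rw [Iso.refl_hom, Iso.refl_hom, Category.comp_id, Category.id_comp]

end Literature.AlgebraicGeometry.Deformation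

end
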